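import Summits.CriticalPhenomena.PercolationContinuityZ3.Theorems.PercNearOneGluingNoHeavyLowerTailCubicThreePointHubEdgeC0
import Summits.CriticalPhenomena.PercolationContinuityZ3.Theorems.PercNearOneGluingNoHeavyLowerTailCubicThreePointHubEdgeC1
import Summits.CriticalPhenomena.PercolationContinuityZ3.Theorems.PercNearOneGluingNoHeavyLowerTailCubicThreePointHubEdgeC2
import Summits.CriticalPhenomena.PercolationContinuityZ3.Theorems.PercNearOneGluingNoHeavyLowerTailCubicThreePointHubEdgeAG
import Summits.CriticalPhenomena.PercolationContinuityZ3.Theorems.PercNearOneGluingNoHeavyLowerTailCubicThreePointSharpDichotomy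
import Mathlib.Tactic.Ring
import Mathlib.Tactic.Linarith
import Mathlib.Tactic.Positivity
import HarnessLib

/-!
# `NoHeavyLowerTail` (stmt-CriticalPhenomena-4575) — the HUB-EDGE THEOREM, dense side (`Ha`)

Support file (prover prim-gen-kcluster gen 10, k-cluster line; `--supports stmt-CriticalPhenomena-4575`).  Pure polynomial algebra over `ℝ`:
no measure theory, no definitions, no named facts, no sorries.  Cell convention `(q,u₁,u₂,u₃,t) = (P(a|b|c),P(ab|c),P(ac|b),P(bc|a),P(abc))`
and forms `AG = qt − e₂(u)`, `Ha = t·AG − e₃`, `Hb = q·AG − e₃` of `…CubicThreePointTerminalClosure`; sharp row `Hmax3 = max(Ha,Hb) ≥ 0`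
(`…CubicThreePointSharpDichotomy`: `⟺ P(abc)² ≥ P(ab)P(ac)P(bc) ∨ P(a|b|c)² ≥ ∏ P(i ∤ rest)`; proved on all series–parallel laws by
`SPLaw.sharp`, `…CubicThreePointSeriesParallel`).  `H₂ = K_{2,3} +` hub edge is the smallest three-terminal graph that is not series–parallel:
two hubs with independent arms `a, b, c` resp. `A, B, C` to the terminals and a hub–hub edge of probability `p`; conditioning on that edge its law
is the segment `L_p = (1−p)·w + p·z`, `w = x ⊙ y` (the two star laws in parallel, `K_{2,3}`), `z =` the MERGED star (arms `a + A − aA`, …).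

THIS FILE (`hubEdge_Ha_nonneg`): for all arms and `p` in `[0,1]`, `t ≥ q ⇒ Ha(L_p) ≥ 0`, i.e. `P(abc)² ≥ P(ab)P(ac)P(bc)` on `H₂` — covering the
dense and the crossing regime at once.  PROOF: `Ha(L_p)` is a cubic in `p` (Bernstein form `Ha_segment_bernstein`, file `…HubEdgeAG`); the
certificate pieces `hubEdge_C0/C1/C2_nonneg` bound its Bernstein coefficients below by the regime multiplier times box-nonnegative polynomials
`σ₀, σ₁`; recombining (`segment_recombine`) leaves a sum of manifestly nonnegative products.  The companion file treats the other
side; `…CubicThreePointHubEdge` assembles `max(Ha,Hb) ≥ 0` and `AG ≥ 0`.  Consequence (with the K3-semigroup theorem): the sharp row `Hmax3 ≥ 0`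
holds for every weighted graph whose Steiner part has components of size `≤ 2` (memo run/shared/lean/prim/prim-gen-kcluster/KCLUSTER-gen10.md §3).
[cite: Gladkov2024StrongFKG, Cor. 4.2 (AG)]
-/

namespace Summit.CriticalPhenomena.PercolationContinuityZ3.Theorems

namespace CubicThreePointHub

open CubicThreePointTerminal

set_option maxRecDepth 16384 in
set_option maxHeartbeats 4000000 in
/-- **Hub-edge theorem, dense side.**  For arms and hub edge in `[0,1]`: `t ≥ q ⇒ Ha(L_p) ≥ 0`, i.e. `P(abc)² ≥ P(ab)P(ac)P(bc)` on
`K_{2,3} +` hub edge. [folklore] -/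
theorem hubEdge_Ha_nonneg {p a b c A B C qw w₁ w₂ w₃ tw qz z₁ z₂ z₃ tz q u₁ u₂ u₃ t : ℝ}
    (hp₀ : 0 ≤ p) (hp₁ : p ≤ 1) (ha₀ : 0 ≤ a) (ha₁ : a ≤ 1) (hb₀ : 0 ≤ b) (hb₁ : b ≤ 1) (hc₀ : 0 ≤ c) (hc₁ : c ≤ 1)
    (hA₀ : 0 ≤ A) (hA₁ : A ≤ 1) (hB₀ : 0 ≤ B) (hB₁ : B ≤ 1) (hC₀ : 0 ≤ C) (hC₁ : C ≤ 1)
    (hqw : qw = (1 - (a * b + a * c + b * c) + 2 * (a * b * c)) * (1 - (A * B + A * C + B * C) + 2 * (A * B * C)))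
    (hw₁ : w₁ = (1 - (a * b + a * c + b * c) + 2 * (a * b * c)) * (A * B * (1 - C)) + a * b * (1 - c) * (1 - (A * B + A * C + B * C) + 2 * (A * B * C))
        + a * b * (1 - c) * (A * B * (1 - C)))
    (hw₂ : w₂ = (1 - (a * b + a * c + b * c) + 2 * (a * b * c)) * (A * C * (1 - B)) + a * c * (1 - b) * (1 - (A * B + A * C + B * C) + 2 * (A * B * C))
        + a * c * (1 - b) * (A * C * (1 - B)))
    (hw₃ : w₃ = (1 - (a * b + a * c + b * c) + 2 * (a * b * c)) * (B * C * (1 - A)) + b * c * (1 - a) * (1 - (A * B + A * C + B * C) + 2 * (A * B * C))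
        + b * c * (1 - a) * (B * C * (1 - A)))
    (htw : tw = a * b * c * ((1 - (A * B + A * C + B * C) + 2 * (A * B * C)) + A * B * (1 - C) + A * C * (1 - B) + B * C * (1 - A) + A * B * C)
        + A * B * C * ((1 - (a * b + a * c + b * c) + 2 * (a * b * c)) + a * b * (1 - c) + a * c * (1 - b) + b * c * (1 - a))
       
        + (a * b * (1 - c) * (A * C * (1 - B) + B * C * (1 - A)) + a * c * (1 - b) * (A * B * (1 - C) + B * C * (1 - A))
        + b * c * (1 - a) * (A * B * (1 - C) + A * C * (1 - B))))
    (hqz : qz = 1 - ((a + A - a * A) * (b + B - b * B) + (a + A - a * A) * (c + C - c * C) + (b + B - b * B) * (c + C - c * C)) + 2 * ((a + A - a * A) * (b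
        + B - b * B) * (c + C - c * C)))
    (hz₁ : z₁ = (a + A - a * A) * (b + B - b * B) * (1 - (c + C - c * C)))
    (hz₂ : z₂ = (a + A - a * A) * (c + C - c * C) * (1 - (b + B - b * B)))
    (hz₃ : z₃ = (b + B - b * B) * (c + C - c * C) * (1 - (a + A - a * A)))
    (htz : tz = (a + A - a * A) * (b + B - b * B) * (c + C - c * C))
    (hq : q = (1 - p) * qw + p * qz) (hu₁ : u₁ = (1 - p) * w₁ + p * z₁) (hu₂ : u₂ = (1 - p) * w₂ + p * z₂)
    (hu₃ : u₃ = (1 - p) * w₃ + p * z₃) (ht : t = (1 - p) * tw + p * tz)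
    (hδ : q ≤ t) : 0 ≤ Ha q u₁ u₂ u₃ t := by
  have h0 := hubEdge_C0_nonneg ha₀ ha₁ hb₀ hb₁ hc₀ hc₁ hA₀ hA₁ hB₀ hB₁ hC₀ hC₁ hqw hw₁ hw₂ hw₃ htw
  have h1 := hubEdge_C1_nonneg ha₀ ha₁ hb₀ hb₁ hc₀ hc₁ hA₀ hA₁ hB₀ hB₁ hC₀ hC₁ hqw hw₁ hw₂ hw₃ htw hqz hz₁ hz₂ hz₃ htz
  have h2 := hubEdge_C2_nonneg ha₀ ha₁ hb₀ hb₁ hc₀ hc₁ hA₀ hA₁ hB₀ hB₁ hC₀ hC₁ hqw hw₁ hw₂ hw₃ htw hqz hz₁ hz₂ hz₃ htz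
  set σ₀ : ℝ := ((1 - a) * (1 - a) * (b * ((1 - b) * (c * ((1 - c) * (A * A * (B * ((1 - B) * (C * ((1 - C)))))))
        + c * c * (A * A * (B * ((1 - B) * (C * ((1 - C)))))))) + b * b * (c * ((1 - c) * (A * A * (B * ((1 - B) * (C * ((1 - C))))))))))
        + a * ((1 - a) * (((1 - b) * (1 - b) * (c * ((1 - c) * (A * ((1 - A) * (B * B * (C * ((1 - C)))))))
        + c * c * (A * ((1 - A) * (B * B * (C * ((1 - C)))))))) + b * ((1 - b) * ((1 - c) * (1 - c) * (A * ((1 - A) * (B * ((1 - B) * (C * C)))))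
        + c * c * (A * ((1 - A) * (B * ((1 - B) * ((1 - C) * (1 - C))) + B * B * ((1 - C) * (1 - C) + C * ((1 - C)))))
        + A * A * (B * ((1 - B) * ((1 - C) * (1 - C) + C * ((1 - C)))))))) + b * b * ((1 - c) * (1 - c) * (A * ((1 - A) * (B * ((1 - B) * (C * C)))))
        + c * ((1 - c) * (A * ((1 - A) * (((1 - B) * (1 - B) * (C * ((1 - C)) + C * C)) + B * ((1 - B) * (C * C))))
        + A * A * ((1 - B) * (1 - B) * (C * ((1 - C))) + B * ((1 - B) * (C * ((1 - C))))))))))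
        + a * a * ((1 - b) * (1 - b) * (c * ((1 - c) * (A * ((1 - A) * (B * B * (C * ((1 - C))))))))
        + b * ((1 - b) * ((1 - c) * (1 - c) * (A * ((1 - A) * (B * ((1 - B) * (C * C))))) + c * ((1 - c) * (((1 - A) * (1 - A) * (B * ((1 - B) * (C * ((1 - C))
        + C * C)) + B * B * (C * ((1 - C))))) + A * ((1 - A) * (B * ((1 - B) * (C * C)) + B * B * (C * ((1 - C)))))))))) with hσ₀
  set σ₁ : ℝ := ((1 - a) * (1 - a) * (b * ((1 - b) * (c * c * (A * A * (B * ((1 - B) * ((1 - C) * (1 - C) + C * ((1 - C))))))))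
        + b * b * (c * ((1 - c) * (A * A * ((1 - B) * (1 - B) * (C * ((1 - C))) + B * ((1 - B) * (C * ((1 - C))))))))))
        + a * ((1 - a) * (((1 - b) * (1 - b) * (c * c * (A * ((1 - A) * (B * B * ((1 - C) * (1 - C) + C * ((1 - C))))))))
        + b * ((1 - b) * (c * c * (A * ((1 - A) * (B * B * ((1 - C) * (1 - C) + C * ((1 - C))))) + A * A * (B * ((1 - B) * ((1 - C) * (1 - C)
        + C * ((1 - C)))))))) + b * b * (((1 - c) * (1 - c) * (A * ((1 - A) * ((1 - B) * (1 - B) * (C * C) + B * ((1 - B) * (C * C))))))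
        + c * ((1 - c) * (A * ((1 - A) * ((1 - B) * (1 - B) * (C * C) + B * ((1 - B) * (C * C)))) + A * A * ((1 - B) * (1 - B) * (C * ((1 - C)))
        + B * ((1 - B) * (C * ((1 - C)))))))))) + a * a * (((1 - b) * (1 - b) * (c * ((1 - c) * ((1 - A) * (1 - A) * (B * B * (C * ((1 - C))))
        + A * ((1 - A) * (B * B * (C * ((1 - C))))))))) + b * ((1 - b) * (((1 - c) * (1 - c) * ((1 - A) * (1 - A) * (B * ((1 - B) * (C * C)))
        + A * ((1 - A) * (B * ((1 - B) * (C * C)))))) + c * ((1 - c) * (((1 - A) * (1 - A) * (B * ((1 - B) * (C * C)) + B * B * (C * ((1 - C)))))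
        + A * ((1 - A) * (B * ((1 - B) * (C * C)) + B * B * (C * ((1 - C)))))))))) with hσ₁
  have hS0 : 0 ≤ σ₀ := by
    rw [hσ₀]
    set a' := 1 - a with ha
    set b' := 1 - b with hb
    set c' := 1 - c with hc
    set A' := 1 - A with hA
    set B' := 1 - B with hB
    set C' := 1 - C with hC
    have ha' : 0 ≤ a' := by linarith
    have hb' : 0 ≤ b' := by linarith
    have hc' : 0 ≤ c' := by linarith
    have hA' : 0 ≤ A' := by linarith
    have hB' : 0 ≤ B' := by linarith
    have hC' : 0 ≤ C' := by linarith
    positivity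
  have hS1 : 0 ≤ σ₁ := by
    rw [hσ₁]
    set a' := 1 - a with ha
    set b' := 1 - b with hb
    set c' := 1 - c with hc
    set A' := 1 - A with hA
    set B' := 1 - B with hB
    set C' := 1 - C with hC
    have ha' : 0 ≤ a' := by linarith
    have hb' : 0 ≤ b' := by linarith
    have hc' : 0 ≤ c' := by linarith
    have hA' : 0 ≤ A' := by linarith
    have hB' : 0 ≤ B' := by linarith
    have hC' : 0 ≤ C' := by linarith
    positivity
  have hp' : 0 ≤ 1 - p := by linarith
  have hδ' : 0 ≤ (1 - p) * (tw - qw) + p * (tz - qz) := by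
    have e : (1 - p) * (tw - qw) + p * (tz - qz) = t - q := by rw [hq, ht]; ring
    rw [e]; linarith
  have key : Ha q u₁ u₂ u₃ t
      = (1 - p) ^ 3 * (Ha qw w₁ w₂ w₃ tw - (tw - qw) * σ₀)
      + p * (1 - p) ^ 2 * (3 * Ha qw w₁ w₂ w₃ tw + (tw * tw * (qz - qw) + (2 * qw * tw - (w₁ * w₂ + w₁ * w₃ + w₂ * w₃)) * (tz - tw) - (tw * (w₂ + w₃) + w₂ * w₃) * (z₁ - w₁)
        - (tw * (w₁ + w₃) + w₁ * w₃) * (z₂ - w₂) - (tw * (w₁ + w₂) + w₁ * w₂) * (z₃ - w₃))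
      - (tw - qw) * σ₁ - (tz - qz) * σ₀)
      + p ^ 2 * (1 - p) * (3 * Ha qz z₁ z₂ z₃ tz - (tz * tz * (qz - qw) + (2 * qz * tz - (z₁ * z₂ + z₁ * z₃ + z₂ * z₃)) * (tz - tw) - (tz * (z₂ + z₃) + z₂ * z₃) * (z₁ - w₁)
        - (tz * (z₁ + z₃) + z₁ * z₃) * (z₂ - w₂) - (tz * (z₁ + z₂) + z₁ * z₂) * (z₃ - w₃))
      - (tz - qz) * σ₁)
      + p ^ 3 * Ha qz z₁ z₂ z₃ tz
      + (1 - p) * ((1 - p) * (tw - qw) + p * (tz - qz)) * ((1 - p) * σ₀ + p * σ₁) := by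
    rw [hq, hu₁, hu₂, hu₃, ht, Ha_segment_bernstein]
    exact segment_recombine p (Ha qw w₁ w₂ w₃ tw) (tw * tw * (qz - qw) + (2 * qw * tw - (w₁ * w₂ + w₁ * w₃ + w₂ * w₃)) * (tz - tw) - (tw * (w₂ + w₃) + w₂ * w₃) * (z₁ - w₁)
        - (tw * (w₁ + w₃) + w₁ * w₃) * (z₂ - w₂) - (tw * (w₁ + w₂) + w₁ * w₂) * (z₃ - w₃)) (Ha qz z₁ z₂ z₃ tz) (tz * tz * (qz - qw) + (2 * qz * tz - (z₁ * z₂ + z₁ * z₃ + z₂ * z₃)) * (tz - tw) - (tz * (z₂ + z₃) + z₂ * z₃) * (z₁ - w₁)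
        - (tz * (z₁ + z₃) + z₁ * z₃) * (z₂ - w₂) - (tz * (z₁ + z₂) + z₁ * z₂) * (z₃ - w₃)) (tw - qw) (tz - qz) σ₀ σ₁
  have e1 : 0 ≤ (1 - p) ^ 3 * (Ha qw w₁ w₂ w₃ tw - (tw - qw) * σ₀) := mul_nonneg (pow_nonneg hp' 3) h0
  have e2 : 0 ≤ p * (1 - p) ^ 2 * (3 * Ha qw w₁ w₂ w₃ tw + (tw * tw * (qz - qw) + (2 * qw * tw - (w₁ * w₂ + w₁ * w₃ + w₂ * w₃)) * (tz - tw) - (tw * (w₂ + w₃) + w₂ * w₃) * (z₁ - w₁)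
        - (tw * (w₁ + w₃) + w₁ * w₃) * (z₂ - w₂) - (tw * (w₁ + w₂) + w₁ * w₂) * (z₃ - w₃))
      - (tw - qw) * σ₁ - (tz - qz) * σ₀) :=
    mul_nonneg (mul_nonneg hp₀ (pow_nonneg hp' 2)) h1
  have e3 : 0 ≤ p ^ 2 * (1 - p) * (3 * Ha qz z₁ z₂ z₃ tz - (tz * tz * (qz - qw) + (2 * qz * tz - (z₁ * z₂ + z₁ * z₃ + z₂ * z₃)) * (tz - tw) - (tz * (z₂ + z₃) + z₂ * z₃) * (z₁ - w₁)
        - (tz * (z₁ + z₃) + z₁ * z₃) * (z₂ - w₂) - (tz * (z₁ + z₂) + z₁ * z₂) * (z₃ - w₃))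
      - (tz - qz) * σ₁) :=
    mul_nonneg (mul_nonneg (pow_nonneg hp₀ 2) hp') h2
  have hz0 : Ha qz z₁ z₂ z₃ tz = 0 := by
    rw [hqz, hz₁, hz₂, hz₃, htz]; exact CubicThreePointSharp.Ha_star _ _ _
  have e4 : 0 ≤ p ^ 3 * Ha qz z₁ z₂ z₃ tz := by rw [hz0, mul_zero]
  have e5 : 0 ≤ (1 - p) * ((1 - p) * (tw - qw) + p * (tz - qz)) * ((1 - p) * σ₀ + p * σ₁) :=
    mul_nonneg (mul_nonneg hp' hδ') (add_nonneg (mul_nonneg hp' hS0) (mul_nonneg hp₀ hS1))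
  rw [key]
  exact add_nonneg (add_nonneg (add_nonneg (add_nonneg e1 e2) e3) e4) e5

end CubicThreePointHub

end Summit.CriticalPhenomena.PercolationContinuityZ3.Theorems
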